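import Summits.CriticalPhenomena.PercolationContinuityZ3.Theorems.PercNearOneGluingNoHeavyPcintBSMXSym2
import HarnessLib

/-!
# PCINT lane, PHASE 9 (block renewal with reach-`m` pieces): orbit reductions in the transverse plane, general boxes

Cell `prim-pcint`, seat `prim-pcint-1` (gen 17); memo `run/shared/lean/prim/pcint/T-FIBRE-ROUTE.md` §PHASE 9.

The dihedral reductions of …PcintBSMXSym2 (`BSMX.gen2`, `BSMX.applyW2`, `BSMX.certZ_of_reps2`, `BSMX.boxV_of_reps2`)
were stated for the reach-two boxes `[-4,4]^2` / `[-8,8]^2`.  Here the same statements for GENERAL radii: the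
generators permute every box `[-R,R]^2` (**`BSMR.boxList_perm_gen2`**, proved structurally: an injective self-map of
a `Nodup` enumeration of the box), the potential sums over `[-R₁,R₁]^2` are invariant (`BSMR.boxSum_gen2`), and the
orbit reductions of the potential-table checks on `[-R₂,R₂]^2` (**`BSMR.boxV_of_reps`**) and of the integer certificate
`BSM.certLHSz` on `[-R₁,R₁]^2` (**`BSMR.certZ_of_reps`**) to lists of representatives with witness words.
-/

noncomputable section

namespace Summit.CriticalPhenomena.PercolationContinuityZ3.Theorems.Pcint.BSMR

open Finset OSM BSM BSMX Literature.Probability.Percolation Literature.Probability.LatticeModels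

variable {np : ℕ}

/-! ### The generators permute every box -/

/-- The generators preserve the box `[-R,R]^2`. -/
theorem gen2_mem_boxList (g : Fin 3) (R : ℕ) {y : Fin 2 → ℤ} (hy : y ∈ boxList 2 R) : gen2 g y ∈ boxList 2 R := by
  rw [mem_boxList] at hy ⊢
  intro i
  unfold gen2
  split_ifs with h0 h1
  · have := hy i; simp only [Pi.neg_apply]; omega
  · unfold pv; exact hy _
  · unfold negC
    split_ifs
    · have := hy i; omega
    · exact hy i

/-- The generators are involutions. -/
theorem gen2_gen2 (g : Fin 3) (y : Fin 2 → ℤ) : gen2 g (gen2 g y) = y := by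
  unfold gen2
  split_ifs with h0 h1
  · simp
  · unfold pv; funext i; simp
  · unfold negC; funext i; split_ifs <;> simp

/-- **The generators permute `[-R,R]^2`.** -/
theorem boxList_perm_gen2 (g : Fin 3) (R : ℕ) : ((boxList 2 R).map (gen2 g)).Perm (boxList 2 R) := by
  have hinj : Function.Injective (gen2 g) := fun a b h => by
    have := congr_arg (gen2 g) h; rwa [gen2_gen2, gen2_gen2] at this
  refine List.perm_of_nodup_nodup_toFinset_eq ((nodup_boxList 2 R).map hinj) (nodup_boxList 2 R) ?_
  ext y
  rw [List.mem_toFinset, List.mem_toFinset, List.mem_map]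
  constructor
  · rintro ⟨z, hz, rfl⟩; exact gen2_mem_boxList g R hz
  · intro hy; exact ⟨gen2 g y, gen2_mem_boxList g R hy, gen2_gen2 g y⟩

/-- The potential sums over `[-R₁,R₁]^2` are invariant under the generators. -/
theorem boxSum_gen2 (R₁ : ℕ) (Gn Φn : (Fin 2 → ℤ) → ℕ) (Tn : ℕ) (hΦ : ∀ g u, Φn (gen2 g u) = Φn u) (g : Fin 3)
    (u : Fin 2 → ℤ) :
    ((boxList 2 R₁).map fun z => (Gn (canonK (z - gen2 g u)) + Tn) * Φn z).sum =
      ((boxList 2 R₁).map fun z => (Gn (canonK (z - u)) + Tn) * Φn z).sum := by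
  rw [← ((boxList_perm_gen2 g R₁).map (fun z => (Gn (canonK (z - gen2 g u)) + Tn) * Φn z)).sum_eq, List.map_map]
  congr 1
  refine List.map_congr_left fun z _ => ?_
  simp only [Function.comp_apply, gen2_sub, canonK_gen2, hΦ]

/-- **Orbit reduction of the potential-table checks** (`[-R₂,R₂]^2` → representatives; sums over `[-R₁,R₁]^2`). -/
theorem boxV_of_reps (R₁ R₂ : ℕ) (Gn Vn Φn : (Fin 2 → ℤ) → ℕ) (Tn c : ℕ) (hΦ : ∀ g u, Φn (gen2 g u) = Φn u)
    (hV : ∀ g u, Vn (gen2 g u) = Vn u) (R : List (Fin 2 → ℤ)) (G : List (List (Fin 3)))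
    (hclos : ∀ u ∈ boxList 2 R₂, ∃ w ∈ G, applyW2 w u ∈ R)
    (hR : ∀ u ∈ R, c + ((boxList 2 R₁).map fun z => (Gn (canonK (z - u)) + Tn) * Φn z).sum ≤ Vn u) :
    ∀ u ∈ boxList 2 R₂, c + ((boxList 2 R₁).map fun z => (Gn (canonK (z - u)) + Tn) * Φn z).sum ≤ Vn u := by
  intro u hu
  obtain ⟨w, _, hw⟩ := hclos u hu
  have h1 := applyW2_invariant' (fun u => ((boxList 2 R₁).map fun z => (Gn (canonK (z - u)) + Tn) * Φn z).sum)
    (fun g u => boxSum_gen2 R₁ Gn Φn Tn hΦ g u) w u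
  have h2 := applyW2_invariant' Vn hV w u
  have := hR _ hw
  rw [h1, h2] at this
  exact this

/-- **Orbit reduction of the integer certificate** (`[-R₁,R₁]^2` → representatives), any shared-key count `St`
that agrees with `BSM.S`. -/
theorem certZ_of_reps (R₁ : ℕ) (pc : Fin np → List (Fin 2 × Bool)) {pe : Fin np → (Fin 2 → ℤ)}
    (hpe : ∀ σ, pe σ = pend (pc σ)) {k : ℕ} (St : (Fin 2 → ℤ) → Fin np → Fin np → ℕ)
    (hSt : ∀ y σ σ', St y σ σ' = S pc k y σ σ') (W : Fin np → ℕ) (hk : 1 ≤ k) (A : ℕ) {B E : ℕ}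
    (hB : 0 < B) (hE : ∀ σ, (pc σ).length + 1 ≤ E) (π₁ π₂ : Fin np ≃ Fin np)
    (hπ₁ : ∀ σ, pc (π₁ σ) = (pc σ).map (pq (Equiv.swap 0 1)))
    (hπ₂ : ∀ σ, pc (π₂ σ) = (pc σ).map (flipAx 0))
    (hW₁ : ∀ σ, W (π₁ σ) = W σ) (hW₂ : ∀ σ, W (π₂ σ) = W σ)
    (V0n V1n Φn : (Fin 2 → ℤ) → ℕ) (hV0 : ∀ g u, V0n (gen2 g u) = V0n u) (hV1 : ∀ g u, V1n (gen2 g u) = V1n u)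
    (hΦ : ∀ g u, Φn (gen2 g u) = Φn u) (DΦ M : ℤ) (R : List (Fin 2 → ℤ)) (G : List (List (Fin 3)))
    (hclos : ∀ y ∈ boxList 2 R₁, ∃ w ∈ G, applyW2 w y ∈ R)
    (hR : ∀ y ∈ R, certLHSz pe St W k A B E V0n V1n y * DΦ ≤ (Φn y : ℤ) * M) :
    ∀ y ∈ boxList 2 R₁, certLHSz pe St W k A B E V0n V1n y * DΦ ≤ (Φn y : ℤ) * M := by
  have hV0a : ∀ u, V0n (-u) = V0n u := fun u => by rw [← (gen2_apply u).1]; exact hV0 0 u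
  have hV0b : ∀ u, V0n (pv (Equiv.swap 0 1) u) = V0n u := fun u => by rw [← (gen2_apply u).2.1]; exact hV0 1 u
  have hV1a : ∀ u, V1n (-u) = V1n u := fun u => by rw [← (gen2_apply u).1]; exact hV1 0 u
  have hV1b : ∀ u, V1n (pv (Equiv.swap 0 1) u) = V1n u := fun u => by rw [← (gen2_apply u).2.1]; exact hV1 1 u
  have hV0d : ∀ u, V0n (negC 0 u) = V0n u := fun u => by rw [← (gen2_apply u).2.2]; exact hV0 2 u
  have hV1d : ∀ u, V1n (negC 0 u) = V1n u := fun u => by rw [← (gen2_apply u).2.2]; exact hV1 2 u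
  have hS2 : St = S pc k := funext fun y => funext fun σ => funext fun σ' => hSt y σ σ'
  rw [hS2] at hR ⊢
  set f : (Fin 2 → ℤ) → ℤ := fun y => certLHSz pe (S pc k) W k A B E V0n V1n y with hf
  have hcast : ∀ z, ((f z : ℤ) : ℝ) = certLHS pc (fun σ => (W σ : ℝ) / (1 : ℕ)) k ((A : ℕ) / (B : ℝ))
      (fun u => (V0n u : ℝ) / (1 : ℕ)) (fun u => (V1n u : ℝ) / (1 : ℕ)) z *
        ((k : ℝ) * (B : ℝ) ^ E * ((1 : ℕ) : ℝ) ^ 2 * (1 : ℕ)) := fun z =>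
    certLHSz_cast pc hpe W hk A hB hE V0n V1n z Nat.one_pos Nat.one_pos
  have h0 : ∀ z, f (-z) = f z := fun z => by
    apply Int.cast_injective (α := ℝ)
    rw [hcast, hcast, certLHS_neg pc _ k _ (fun u => by simp only [hV0a]) (fun u => by simp only [hV1a])]
  have h1 : ∀ z, f (pv (Equiv.swap 0 1) z) = f z := fun z => by
    apply Int.cast_injective (α := ℝ)
    rw [hcast, hcast, certLHS_perm pc _ k _ (Equiv.swap 0 1) π₁ hπ₁ (fun σ => by simp only [hW₁])
      (fun u => by simp only [hV0b]) (fun u => by simp only [hV1b])]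
  have h3 : ∀ z, f (negC 0 z) = f z := fun z => by
    apply Int.cast_injective (α := ℝ)
    rw [hcast, hcast, certLHS_flip pc _ k _ 0 π₂ hπ₂ (fun σ => by simp only [hW₂])
      (fun u => by simp only [hV0d]) (fun u => by simp only [hV1d])]
  have hgen : ∀ g z, f (gen2 g z) = f z := fun g z => by
    rcases gen2_apply z with ⟨e0, e1, e2⟩
    fin_cases g
    · exact (congr_arg f e0).trans (h0 z)
    · exact (congr_arg f e1).trans (h1 z)
    · exact (congr_arg f e2).trans (h3 z)
  intro y hy
  obtain ⟨w, _, hwR⟩ := hclos y hy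
  have hfy : f (applyW2 w y) = f y := applyW2_invariant' f hgen w y
  have hΦy : Φn (applyW2 w y) = Φn y := applyW2_invariant' Φn hΦ w y
  have := hR _ hwR
  rw [← hΦy]
  rw [hf] at hfy
  simp only at hfy
  rw [← hfy]
  exact this

/-- Closure of a box under witness words, from a zipped witness list (decidable form). -/
theorem closure_of_zip (R₀ : ℕ) (reps : List (Fin 2 → ℤ)) (wl : List (List (Fin 3)))
    (hlen : (boxList 2 R₀).length ≤ wl.length)
    (h : ∀ p ∈ (boxList 2 R₀).zip wl, applyW2 p.2 p.1 ∈ reps) :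
    ∀ y ∈ boxList 2 R₀, ∃ w ∈ wl, applyW2 w y ∈ reps := by
  intro y hy
  obtain ⟨i, hi, rfl⟩ := List.getElem_of_mem hy
  have hiw : i < wl.length := lt_of_lt_of_le hi hlen
  have hmem : ((boxList 2 R₀)[i], wl[i]) ∈ (boxList 2 R₀).zip wl := by
    rw [List.mem_iff_getElem]
    exact ⟨i, by rw [List.length_zip]; exact lt_min hi hiw, by rw [List.getElem_zip]⟩
  exact ⟨wl[i], List.getElem_mem hiw, h _ hmem⟩

end Summit.CriticalPhenomena.PercolationContinuityZ3.Theorems.Pcint.BSMR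

end
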